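import Literature.Analysis.FluidPDE.LuoTitiPerturbation
import Literature.Analysis.FluidPDE.JetDerivBounds
import Literature.Analysis.FluidPDE.JetSupports
import Literature.Analysis.FluidPDE.FracHyperviscousEstimate
import Literature.Analysis.FluidPDE.JetVelocityEstimates
import HarnessLib

/-!
# Luo–Titi's perturbation: the hyperviscous stress term `ℛ(ν(-Δ)^θ w)` (Luo–Titi 2020, (3.20))

Analysis/FluidPDE support file (everything proved; no named facts) for the proof of the Iteration
Lemma of T. Luo and E. S. Titi, Calc. Var. PDE 59 (2020) = arXiv:1808.07595
(`Torus.LuoTiti2020_iterationLemma`). The decisive estimate of the paper is (3.20):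
"`ν^{1/2}‖ℛ((-Δ)^θ w_{q+1})‖_{L^p} ≲ ‖|∇|^{2θ-1} w_{q+1}‖_{L^p} ≲ r^{3/2-3/p} λ_{q+1}^{2θ-1}`,
which is small if `θ < 5/4` and `p - 1` sufficiently small" — an anti-divergence of order `-1`,
`2θ - 1` derivatives each costing the frequency, and the intermittency gain `r^{3/2-3/p}` of the
`L^p` norm of the concentrated building block. This file proves the corresponding bound for the
LOCAL part `wloc = ψ•wpc + ψ²•X` of the cut-off jet perturbation of `LuoTitiPerturbation` (the
gradient part `∇(ψ²ζ)` having been routed into the pressure, `LuoTitiPerturbationFracNSR`), in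
the `sup × |support|^{1/p}` form of `FracHyperviscousEstimate`:

* `JetStep.Datum.Lstar` — the frequency scale `L⋆ = 3Λ₀σμ` of the jets (each space derivative of
  `η_x, ψ̃_x, ∇φ̃_x` costs at most `L⋆`, `JetDerivBounds`);
* `JetStep.Datum.exists_blockBounds` — uniform derivative bounds (`HasDerivBounds`, all orders)
  of the blocks `η_x` (size `√κ`), the columns of `Om_x` (size `√κ σ⁻¹`) and `η_x²ψ̃_x²`
  (size `κμ²`) at frequency `L⋆`, with constants depending only on the bump and the order;
* `JetStep.Datum.hasDerivBounds_wpc`, `hasDerivBounds_X₀` — hence of `wpc = ∑ div(a_x Om_x)`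
  (size `≲ ‖a‖_{C^{N+1}} √κ σ⁻¹ L⋆ ≂ √κ μ`) and of the local part `X₀ = -μ′⁻¹∑ F_x k_x` of `X`
  (size `≲ ‖a‖² κμ²/μ′`), given `C^{N+1}` bounds of the slow amplitudes `a_x`;
* `JetStep.Datum.jetSupports` — the union `E(t)` of the jet supports (`JetSupports`), its measure
  `≤ N κ⁻¹ (4μ)^{-2}|B|`, and the vanishing of `wpc`, `X₀` (hence of all derivatives of `wpc`
  and `X`) off `E(t)`;
* **`LuoTiti.Setup.integral_norm_antidivergence_fracLaplacian_wloc_le`** — for `1 ≤ θ < 2`,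
  `1 < p < ∞`: `∫‖ℛ((-Δ)^θ wloc(t))‖ ≤ C |E(t)|^{1/p} S₁^{2-θ} S₃^{θ-1}` with
  `S₁ = (C_w L⋆ + C_X L⋆)`-type first-derivative and `S₃ = 3 S₁ L⋆²` third-derivative sup bounds.

## References

* T. Luo, E. S. Titi, Calc. Var. PDE 59 (2020) = arXiv:1808.07595, §3.2 (3.6)–(3.7), §3.5 (3.16),
  (3.20). [`LuoTiti2020`]
* T. Buckmaster, V. Vicol, EMS Surv. Math. Sci. 6 (2019) = arXiv:1901.09023, §7.4 (7.19)–(7.24).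
  [`BuckmasterVicol2020`]
-/

noncomputable section

open MeasureTheory Set Filter Topology Function UnitAddTorus
open scoped InnerProductSpace ContDiff ENNReal NNReal

/-! ## A second-order read-out of `HasDerivBounds` -/

namespace Literature.Analysis.FunctionSpaces.Torus.HasDerivBounds

variable {d : Type*} [Fintype d] [DecidableEq d]
variable {F : Type*} [NormedAddCommGroup F] [NormedSpace ℝ F]
variable {n : ℕ} {f : UnitAddTorus d → F} {C L : ℝ}

/-- Second-order read-out: `‖Δ f‖ ≤ |d| C L²`. [folklore] -/
theorem norm_laplacian_le (h : HasDerivBounds n f C L) (hn : 2 ≤ n) (y : UnitAddTorus d) :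
    ‖Torus.laplacian f y‖ ≤ Fintype.card d * (C * L ^ 2) := by
  rw [laplacian_eq_sum_partialDeriv_partialDeriv h.1 y]
  calc ‖∑ i, Torus.partialDeriv i (Torus.partialDeriv i f) y‖
      ≤ ∑ i, ‖Torus.partialDeriv i (Torus.partialDeriv i f) y‖ := norm_sum_le _ _
    _ ≤ ∑ _i : d, C * L ^ 2 := Finset.sum_le_sum fun i _ => by
        have := h.2 [i, i] (by simpa using hn) y
        simpa using this
    _ = Fintype.card d * (C * L ^ 2) := by rw [Finset.sum_const, Finset.card_univ, nsmul_eq_mul]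

/-- Constant rescaling of a finite sum of bounds: `∑_{i ∈ s} c = |s| c`. [folklore] -/
theorem sum_const' {ι : Type*} (s : Finset ι) {g : ι → UnitAddTorus d → F} {c : ℝ}
    (h : ∀ i ∈ s, HasDerivBounds n (g i) c L) :
    HasDerivBounds n (fun y => ∑ i ∈ s, g i y) (s.card * c) L := by
  have := HasDerivBounds.sum s h
  rw [Finset.sum_const, nsmul_eq_mul] at this
  exact this

end Literature.Analysis.FunctionSpaces.Torus.HasDerivBounds

namespace Literature.Analysis.FluidPDE

namespace JetStep

open Literature.Analysis.FunctionSpaces FunctionSpaces.Torus Mikado NashGeometric Jet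

local notation "𝕋³" => UnitAddTorus (Fin 3)
local notation "E³" => EuclideanSpace ℝ (Fin 3)
local notation "Idx" => Index (Fin 3)

namespace Datum

variable {D : Datum} (h : D.Valid)

/-! ## The frequency scale `L⋆ = 3Λ₀σμ` -/

/-- **The frequency scale of the jets**: `L⋆ = 3 Λ₀ σ μ` (`Λ₀ = frameConst`), an upper bound for
the cost of one space derivative of every block (`3σκ ≤ L⋆` when `κ ≤ μ`, `Λ₀σμ ≤ L⋆`).
[cite: LuoTiti2020, §3.2 (3.6)] -/
def Lstar (D : Datum) : ℝ := 3 * Jet.frameConst (Fin 3) * D.σ * D.μ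

include h in
/-- `1 ≤ L⋆`, `3σκ ≤ L⋆` (for `κ ≤ μ`), `Λ₀σμ ≤ L⋆`. [folklore] -/
theorem Lstar_bounds (hκμ : D.κ ≤ D.μ) : 1 ≤ D.Lstar ∧ 3 * ((D.σ : ℝ)) * D.κ ≤ D.Lstar ∧
    Jet.frameConst (Fin 3) * D.σ * D.μ ≤ D.Lstar := by
  obtain ⟨hμ0, hκ0, hσ0, -, hμ1, hκ1, hσ1⟩ := pos h
  have hΛ := Jet.one_le_frameConst (d := Fin 3)
  refine ⟨?_, ?_, ?_⟩
  · unfold Lstar; nlinarith [mul_le_mul hσ1 hμ1 zero_le_one hσ0.le]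
  · unfold Lstar
    calc 3 * ((D.σ : ℝ)) * D.κ ≤ 3 * D.σ * D.μ := by gcongr
      _ = 3 * 1 * D.σ * D.μ := by ring
      _ ≤ 3 * Jet.frameConst (Fin 3) * D.σ * D.μ := by gcongr
  · unfold Lstar; nlinarith [mul_pos hσ0 hμ0]

/-! ## Derivative bounds of the blocks -/

/-- `μ^{((|d|-1)/2 - 1)} = 1` and `μ^{(|d|-1)/2} = μ` in dimension `3`. [folklore] -/
theorem rpow_card_three (μ : ℝ) (_hμ : 0 < μ) :
    μ ^ (((Fintype.card (Fin 3) : ℝ) - 1) / 2 - 1) = 1 ∧ μ ^ (((Fintype.card (Fin 3) : ℝ) - 1) / 2) = μ := by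
  rw [Fintype.card_fin]
  norm_num

/-- **Uniform derivative bounds of the blocks** at frequency `L⋆`: there is `K ≥ 0` (depending on
the bump `g` and the order `N` only) such that for every valid datum with bump `g` and `κ ≤ μ`,
every direction `x` and every time `t`:
`η_x(t)` has bounds `(K√κ, L⋆)`, every column of `Om_x(t)` has bounds `(K√κσ⁻¹, L⋆)`, and
`η_x(t)²ψ̃_x²` has bounds `(Kκμ², L⋆)`. [cite: LuoTiti2020, §3.2 (3.6)–(3.7)] -/
theorem exists_blockBounds {g : ℝ → ℝ} (hg : Intermittent.IsBump g) (N : ℕ) :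
    ∃ K : ℝ, 0 ≤ K ∧ ∀ D : Datum, D.Valid → D.g = g → D.κ ≤ D.μ → ∀ (x : Idx) (t : ℝ),
      HasDerivBounds N (Jet.eta (D.J x) x t) (K * Real.sqrt D.κ) D.Lstar ∧
      (∀ j, HasDerivBounds N (fun z => Jet.Om (D.J x) D.s x t z j) (K * Real.sqrt D.κ * ((D.σ : ℝ))⁻¹) D.Lstar) ∧
      HasDerivBounds N (Jet.fastF (D.J x) D.s x t) (K * D.κ * D.μ ^ 2) D.Lstar := by
  obtain ⟨A, hA0, hA⟩ := Jet.hasDerivBounds_eta (d := Fin 3) hg N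
  obtain ⟨Cφ, hCφ0, hCφ⟩ := Jet.hasDerivBounds_partialDeriv_phiJ (Fin 3) N
  obtain ⟨Cg, hCg0, hCg⟩ := Jet.hasDerivBounds_gradient_phiJ (Fin 3) N
  obtain ⟨Cψ, hCψ0, hCψ⟩ := Jet.hasDerivBounds_psiJ (Fin 3) N
  set Sφ : ℝ := ∑ x, Cφ x with hSφ
  set Sg : ℝ := ∑ x, Cg x with hSg
  set Sψ' : ℝ := ∑ x, Cψ x with hSψ'
  have hSφ0 : 0 ≤ Sφ := Finset.sum_nonneg fun x _ => hCφ0 x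
  have hSg0 : 0 ≤ Sg := Finset.sum_nonneg fun x _ => hCg0 x
  have hSψ0 : 0 ≤ Sψ' := Finset.sum_nonneg fun x _ => hCψ0 x
  have hφle : ∀ x, Cφ x ≤ Sφ := fun x => Finset.single_le_sum (f := Cφ) (fun x _ => hCφ0 x) (Finset.mem_univ x)
  have hgle : ∀ x, Cg x ≤ Sg := fun x => Finset.single_le_sum (f := Cg) (fun x _ => hCg0 x) (Finset.mem_univ x)
  have hψle : ∀ x, Cψ x ≤ Sψ' := fun x => Finset.single_le_sum (f := Cψ) (fun x _ => hCψ0 x) (Finset.mem_univ x)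
  -- the constants
  set Kfr : ℝ := 2 ^ N * Sφ * 3 + 3 * Sg with hKfr
  set KOm : ℝ := 2 ^ N * A * Kfr with hKOm
  set KF : ℝ := 2 ^ N * (2 ^ N * A * A) * (2 ^ N * Sψ' * Sψ') with hKF
  refine ⟨max A (max KOm KF), le_max_of_le_left hA0, fun D hD hDg hκμ x t => ?_⟩
  obtain ⟨hμ0, hκ0, hσ0, -, hμ1, hκ1, hσ1⟩ := pos hD
  obtain ⟨hL1, hL3, hLΛ⟩ := Lstar_bounds hD hκμ
  have hL0 : 0 ≤ D.Lstar := zero_le_one.trans hL1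
  have hΛ0 : (0 : ℝ) < Jet.frameConst (Fin 3) := zero_lt_one.trans_le Jet.one_le_frameConst
  have hJ := Jvalid hD x
  have hsq0 : 0 ≤ Real.sqrt D.κ := Real.sqrt_nonneg _
  obtain ⟨e1, e2⟩ := rpow_card_three D.μ hμ0
  -- η
  have heta : HasDerivBounds N (Jet.eta (D.J x) x t) (A * Real.sqrt D.κ) D.Lstar := by
    have := hA (D.J x) hJ hDg x t
    change HasDerivBounds N _ (A * Real.sqrt D.κ) (3 * ((D.σ : ℝ)) * D.κ) at this
    exact this.mono le_rfl (by positivity) hL3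
  -- ∂ⱼφ̃ and ∇φ̃
  have hφ : ∀ j, HasDerivBounds N (Torus.partialDeriv j (Jet.phiJ (D.J x) D.s x)) (Sφ * ((D.σ : ℝ))⁻¹) D.Lstar := by
    intro j
    have := hCφ (D.J x) hJ D.s x j
    change HasDerivBounds N _ (Cφ x * (((D.σ : ℝ))⁻¹ * D.μ ^ (((Fintype.card (Fin 3) : ℝ) - 1) / 2 - 1)))
      (Jet.frameConst (Fin 3) * D.σ * D.μ) at this
    rw [e1, mul_one] at this
    exact this.mono (mul_le_mul_of_nonneg_right (hφle x) (by positivity)) (by positivity) hLΛ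
  have hgr : HasDerivBounds N (Torus.gradient (Jet.phiJ (D.J x) D.s x)) (Sg * ((D.σ : ℝ))⁻¹) D.Lstar := by
    have := hCg (D.J x) hJ D.s x
    change HasDerivBounds N _ (Cg x * (((D.σ : ℝ))⁻¹ * D.μ ^ (((Fintype.card (Fin 3) : ℝ) - 1) / 2 - 1)))
      (Jet.frameConst (Fin 3) * D.σ * D.μ) at this
    rw [e1, mul_one] at this
    exact this.mono (mul_le_mul_of_nonneg_right (hgle x) (by positivity)) (by positivity) hLΛ
  -- the frame columns
  have hframe : ∀ j, HasDerivBounds N (fun z => Jet.frame (D.J x) D.s x z j) (Kfr * ((D.σ : ℝ))⁻¹) D.Lstar := by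
    intro j
    have h1 : HasDerivBounds N (fun z => Torus.partialDeriv j (Jet.phiJ (D.J x) D.s x) z • dirVec x)
        (2 ^ N * (Sφ * ((D.σ : ℝ))⁻¹) * ‖dirVec x‖) D.Lstar := (hφ j).smul (hasDerivBounds_const N (dirVec x) hL0) hL0
    have h2 : HasDerivBounds N (fun z => (-((dir x j : ℤ) : ℝ)) • Torus.gradient (Jet.phiJ (D.J x) D.s x) z)
        (|(-((dir x j : ℤ) : ℝ))| * (Sg * ((D.σ : ℝ))⁻¹)) D.Lstar := hgr.const_smul _
    have h12 := h1.add h2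
    have e : (fun z => Jet.frame (D.J x) D.s x z j) = fun z => Torus.partialDeriv j (Jet.phiJ (D.J x) D.s x) z • dirVec x +
        (-((dir x j : ℤ) : ℝ)) • Torus.gradient (Jet.phiJ (D.J x) D.s x) z := by
      funext z; simp only [Jet.frame, neg_smul]; abel
    rw [e]
    refine h12.mono ?_ hL0 le_rfl
    have hk : ‖dirVec x‖ ≤ 3 := CL22.norm_dirVec_le x
    have hkj : |(-((dir x j : ℤ) : ℝ))| ≤ 3 := by rw [abs_neg]; exact abs_dir_le x j
    have hσi : 0 ≤ ((D.σ : ℝ))⁻¹ := by positivity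
    calc 2 ^ N * (Sφ * ((D.σ : ℝ))⁻¹) * ‖dirVec x‖ + |(-((dir x j : ℤ) : ℝ))| * (Sg * ((D.σ : ℝ))⁻¹)
        ≤ 2 ^ N * (Sφ * ((D.σ : ℝ))⁻¹) * 3 + 3 * (Sg * ((D.σ : ℝ))⁻¹) := by
          gcongr
      _ = Kfr * ((D.σ : ℝ))⁻¹ := by rw [hKfr]; ring
  -- Om columns
  have hOm : ∀ j, HasDerivBounds N (fun z => Jet.Om (D.J x) D.s x t z j) (KOm * Real.sqrt D.κ * ((D.σ : ℝ))⁻¹) D.Lstar := by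
    intro j
    have := heta.smul (hframe j) hL0
    have e : (fun z => Jet.Om (D.J x) D.s x t z j) = fun z => Jet.eta (D.J x) x t z • Jet.frame (D.J x) D.s x z j := rfl
    rw [e]
    refine this.mono (le_of_eq ?_) hL0 le_rfl
    rw [hKOm]; ring
  -- ψ̃ and the fast product
  have hψ : HasDerivBounds N (Jet.psiJ (D.J x) D.s x) (Sψ' * D.μ) D.Lstar := by
    have := hCψ (D.J x) hJ D.s x
    change HasDerivBounds N _ (Cψ x * D.μ ^ (((Fintype.card (Fin 3) : ℝ) - 1) / 2)) (Jet.frameConst (Fin 3) * D.σ * D.μ) at this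
    rw [e2] at this
    exact this.mono (mul_le_mul_of_nonneg_right (hψle x) hμ0.le) (by positivity) hLΛ
  have hfast : HasDerivBounds N (Jet.fastF (D.J x) D.s x t) (KF * D.κ * D.μ ^ 2) D.Lstar := by
    have h1 := heta.mul heta hL0
    have h2 := hψ.mul hψ hL0
    have h12 := h1.mul h2 hL0
    have e : Jet.fastF (D.J x) D.s x t = fun z => (Jet.eta (D.J x) x t z * Jet.eta (D.J x) x t z) *
        (Jet.psiJ (D.J x) D.s x z * Jet.psiJ (D.J x) D.s x z) := by
      funext z; simp only [Jet.fastF]; ring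
    rw [e]
    refine h12.mono (le_of_eq ?_) hL0 le_rfl
    have hs : Real.sqrt D.κ * Real.sqrt D.κ = D.κ := Real.mul_self_sqrt hκ0.le
    rw [hKF]
    calc 2 ^ N * (2 ^ N * (A * Real.sqrt D.κ) * (A * Real.sqrt D.κ)) * (2 ^ N * (Sψ' * D.μ) * (Sψ' * D.μ))
        = 2 ^ N * (2 ^ N * A * A) * (2 ^ N * Sψ' * Sψ') * (Real.sqrt D.κ * Real.sqrt D.κ) * D.μ ^ 2 := by ring
      _ = _ := by rw [hs]
  -- monotonicity in the constant
  have hm1 : A ≤ max A (max KOm KF) := le_max_left _ _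
  have hm2 : KOm ≤ max A (max KOm KF) := le_trans (le_max_left _ _) (le_max_right _ _)
  have hm3 : KF ≤ max A (max KOm KF) := le_trans (le_max_right _ _) (le_max_right _ _)
  refine ⟨heta.mono (mul_le_mul_of_nonneg_right hm1 hsq0) hL0 le_rfl,
    fun j => (hOm j).mono (mul_le_mul_of_nonneg_right (mul_le_mul_of_nonneg_right hm2 hsq0) (by positivity)) hL0 le_rfl,
    hfast.mono (mul_le_mul_of_nonneg_right (mul_le_mul_of_nonneg_right hm3 hκ0.le) (by positivity)) hL0 le_rfl⟩

/-- The block-bounds property at order `N` with constant `K` (the conclusion of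
`exists_blockBounds`, as a hypothesis of the estimates below). [folklore] -/
def BlockBounds (D : Datum) (N : ℕ) (K : ℝ) : Prop :=
  ∀ (x : Idx) (t : ℝ), HasDerivBounds N (Jet.eta (D.J x) x t) (K * Real.sqrt D.κ) D.Lstar ∧
    (∀ j, HasDerivBounds N (fun z => Jet.Om (D.J x) D.s x t z j) (K * Real.sqrt D.κ * ((D.σ : ℝ))⁻¹) D.Lstar) ∧
    HasDerivBounds N (Jet.fastF (D.J x) D.s x t) (K * D.κ * D.μ ^ 2) D.Lstar

/-! ## Derivative bounds of `wpc` and of the local part of `X` -/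

include h in
/-- **Derivative bounds of `wpc = ∑_x div(a_x Om_x)`**: with `C^{N+1}` bounds `Ca` of the
amplitudes, `wpc(t)` has bounds of order `N` with constant `N_Λ · 3 · 2^{N+1} Ca K √κ σ⁻¹ L⋆`
(`≂ √κ μ`) at frequency `L⋆`. [cite: LuoTiti2020, §3.4 (3.10)–(3.11)] -/
theorem hasDerivBounds_wpc (hκμ : D.κ ≤ D.μ) {N : ℕ} {K : ℝ} (hK : D.BlockBounds (N + 1) K) {Ca : ℝ} {t : ℝ}
    (ha : ∀ x, HasDerivBounds (N + 1) (D.a x t) Ca 1) :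
    HasDerivBounds N (D.wpc t) (NN * (3 * (2 ^ (N + 1) * Ca * (K * Real.sqrt D.κ * ((D.σ : ℝ))⁻¹) * D.Lstar))) D.Lstar := by
  obtain ⟨hL1, -, -⟩ := Lstar_bounds h hκμ
  have hL0 : 0 ≤ D.Lstar := zero_le_one.trans hL1
  have hcol : ∀ x j, HasDerivBounds N (Torus.partialDeriv j (fun z => D.a x t z • Jet.Om (D.J x) D.s x t z j))
      (2 ^ (N + 1) * Ca * (K * Real.sqrt D.κ * ((D.σ : ℝ))⁻¹) * D.Lstar) D.Lstar := by
    intro x j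
    have ha' : HasDerivBounds (N + 1) (D.a x t) Ca D.Lstar := (ha x).mono le_rfl zero_le_one hL1
    exact ((ha'.smul ((hK x t).2.1 j) hL0).partialDeriv j)
  have hx : ∀ x ∈ (Finset.univ : Finset Idx), HasDerivBounds N
      (fun y => Torus.tensorDivergence (fun z j => D.a x t z • Jet.Om (D.J x) D.s x t z j) y)
      (3 * (2 ^ (N + 1) * Ca * (K * Real.sqrt D.κ * ((D.σ : ℝ))⁻¹) * D.Lstar)) D.Lstar := by
    intro x _
    have := HasDerivBounds.sum_const' (Finset.univ : Finset (Fin 3)) (fun j _ => hcol x j)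
    rw [Finset.card_univ, Fintype.card_fin] at this
    simpa [Torus.tensorDivergence] using this
  have := HasDerivBounds.sum Finset.univ hx
  have e : (fun y => ∑ x ∈ Finset.univ, Torus.tensorDivergence (fun z j => D.a x t z • Jet.Om (D.J x) D.s x t z j) y) = D.wpc t := rfl
  rw [e] at this
  exact this.mono (sum_le_NN_mul fun x => le_rfl) hL0 le_rfl

/-- **The local part of the temporal corrector** `X₀ = -μ′⁻¹ ∑_x F_x k_x` (`X = X₀ + const`).
[cite: BuckmasterVicol2020, §7.5.3 (7.37)] -/
def X₀ (D : Datum) (t : ℝ) (y : 𝕋³) : E³ := -∑ x, (D.mup⁻¹ * D.F x t y) • dirVec x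

/-- The space-constant part `∑_x μ′⁻¹ (∫F_x) k_x` of `X`. [folklore] -/
def cX (D : Datum) (t : ℝ) : E³ := ∑ x, (D.mup⁻¹ * ∫ z, D.F x t z) • dirVec x

/-- `X = X₀ + cX`. [folklore] -/
theorem X_eq_X₀_add_cX (t : ℝ) (y : 𝕋³) : D.X t y = D.X₀ t y + D.cX t := by
  simp only [X, X₀, cX, ← Finset.sum_neg_distrib, ← Finset.sum_add_distrib]
  refine Finset.sum_congr rfl fun x _ => ?_
  rw [mul_sub, sub_smul]
  abel

include h in
/-- `X₀` is smooth on the slab. [folklore] -/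
theorem isSmooth_X₀ {t : ℝ} (ht : t ∈ Icc 0 D.T) : Torus.IsSmooth (D.X₀ t) := by
  have hX : Torus.IsSmooth (D.X t) := (smooth_X h).isSmooth_slice ht
  have e : D.X₀ t = D.X t - fun _ => D.cX t := by
    funext y; simp only [Pi.sub_apply, X_eq_X₀_add_cX t y, add_sub_cancel_right]
  rw [e]
  exact hX.sub (Torus.isSmooth_const _)

include h in
/-- `∂ₘX = ∂ₘX₀`. [folklore] -/
theorem partialDeriv_X_eq {t : ℝ} (ht : t ∈ Icc 0 D.T) (m : Fin 3) :
    Torus.partialDeriv m (D.X t) = Torus.partialDeriv m (D.X₀ t) := by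
  have e : D.X t = D.X₀ t + fun _ => D.cX t := funext (X_eq_X₀_add_cX t)
  funext y
  rw [e, partialDeriv_add ((isSmooth_X₀ h ht).isContDiff (by simp)) (isContDiff_const _) m, Pi.add_apply,
    Torus.partialDeriv_const_apply, add_zero]

include h in
/-- **Derivative bounds of `X₀`**: order `N`, constant `N_Λ · μ′⁻¹ · 2^N(2^N Ca²)(Kκμ²) · 3`
(`≂ ‖a‖² κμ²/μ′`) at frequency `L⋆`. [cite: BuckmasterVicol2020, §7.5.3 (7.37)] -/
theorem hasDerivBounds_X₀ (hκμ : D.κ ≤ D.μ) {N : ℕ} {K : ℝ} (hK : D.BlockBounds N K) {Ca : ℝ} {t : ℝ}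
    (ha : ∀ x, HasDerivBounds N (D.a x t) Ca 1) :
    HasDerivBounds N (D.X₀ t) (NN * (2 ^ N * (D.mup⁻¹ * (2 ^ N * (2 ^ N * Ca * Ca) * (K * D.κ * D.μ ^ 2))) * 3)) D.Lstar := by
  obtain ⟨hμ0, hκ0, hσ0, hmup, hμ1, hκ1, hσ1⟩ := pos h
  obtain ⟨hL1, -, -⟩ := Lstar_bounds h hκμ
  have hL0 : 0 ≤ D.Lstar := zero_le_one.trans hL1
  have hx : ∀ x ∈ (Finset.univ : Finset Idx), HasDerivBounds N (fun y => (D.mup⁻¹ * D.F x t y) • dirVec x)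
      (2 ^ N * (D.mup⁻¹ * (2 ^ N * (2 ^ N * Ca * Ca) * (K * D.κ * D.μ ^ 2))) * 3) D.Lstar := by
    intro x _
    have ha' : HasDerivBounds N (D.a x t) Ca D.Lstar := (ha x).mono le_rfl zero_le_one hL1
    have hF : HasDerivBounds N (D.F x t) (2 ^ N * (2 ^ N * Ca * Ca) * (K * D.κ * D.μ ^ 2)) D.Lstar := by
      have := (ha'.mul ha' hL0).mul (hK x t).2.2 hL0
      have e : D.F x t = fun y => D.a x t y * D.a x t y * Jet.fastF (D.J x) D.s x t y := by
        funext y; simp only [F]; ring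
      rw [e]; exact this
    have h1 : HasDerivBounds N (fun y => D.mup⁻¹ * D.F x t y) (|D.mup⁻¹| * (2 ^ N * (2 ^ N * Ca * Ca) * (K * D.κ * D.μ ^ 2))) D.Lstar := by
      have := hF.const_smul D.mup⁻¹
      simp only [smul_eq_mul] at this
      exact this
    have h2 := h1.smul (hasDerivBounds_const N (dirVec x) hL0) hL0
    refine h2.mono ?_ hL0 le_rfl
    rw [abs_of_pos (inv_pos.2 hmup)]
    have hk : ‖dirVec x‖ ≤ 3 := CL22.norm_dirVec_le x
    have hc : 0 ≤ D.mup⁻¹ * (2 ^ N * (2 ^ N * Ca * Ca) * (K * D.κ * D.μ ^ 2)) := by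
      have hCa := (ha x).nonneg
      have hKk : 0 ≤ K * D.κ * D.μ ^ 2 := (hK x t).2.2.nonneg
      positivity
    exact mul_le_mul_of_nonneg_left hk (by positivity)
  have := HasDerivBounds.sum Finset.univ hx
  have e : D.X₀ t = fun y => -(fun y => ∑ x ∈ Finset.univ, (D.mup⁻¹ * D.F x t y) • dirVec x) y := rfl
  rw [e]
  exact (this.mono (sum_le_NN_mul fun x => le_rfl) hL0 le_rfl).neg

/-! ## The jet supports and the vanishing of the local fields off them -/

/-- **The union of the jet supports at time `t`.** [folklore] -/
def jetSupports (D : Datum) (t : ℝ) : Set 𝕋³ := ⋃ x : Idx, Jet.jetSupport (D.J x) D.s x t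

/-- The union of the jet supports is closed. [folklore] -/
theorem isClosed_jetSupports (t : ℝ) : IsClosed (D.jetSupports t) :=
  isClosed_iUnion_of_finite fun _ => Jet.isClosed_jetSupport

/-- The union of the jet supports is measurable. [folklore] -/
theorem measurableSet_jetSupports (t : ℝ) : MeasurableSet (D.jetSupports t) := (isClosed_jetSupports t).measurableSet

include h in
/-- **Measure of the jet supports**: `|E(t)| ≤ N_Λ κ⁻¹ (1/(4μ))² |B_{ℝ²}(0,1)|`-type bound (summed
over the directions). [cite: BuckmasterVicol2020, §7.4 (7.24)] -/
theorem volume_jetSupports_le (t : ℝ) :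
    volume (D.jetSupports t) ≤ ∑ x : Idx, ENNReal.ofReal D.κ⁻¹ *
      (ENNReal.ofReal ((1 / 4 / D.μ) ^ Fintype.card (Slot x)) * volume (Metric.ball (0 : EuclideanSpace ℝ (Slot x)) 1)) :=
  (measure_iUnion_fintype_le volume _).trans (Finset.sum_le_sum fun x _ => Jet.volume_jetSupport_le (Jvalid h x))

include h in
/-- The columns of `Om_x(t)` vanish off the support of the jet `x`. [folklore] -/
theorem Om_eq_zero_of_not_mem (x : Idx) (t : ℝ) {y : 𝕋³} (hy : y ∉ Jet.jetSupport (D.J x) D.s x t) (j : Fin 3) :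
    Jet.Om (D.J x) D.s x t y j = 0 := by
  have hJ := Jvalid h x
  show Jet.eta (D.J x) x t y • Jet.frame (D.J x) D.s x y j = 0
  by_cases htr : (Jet.jetMap (D.J x) D.s x y).2 ∈ Jet.tubeSet (Slot x) (D.J x).μ
  · rw [Jet.eta_eq_zero_of_not_mem hJ hy htr, zero_smul]
  · have h1 := Jet.partialDeriv_phiJ_eq_zero_of_not_mem_tube (s := D.s) hJ j htr
    have h2 := Jet.gradient_phiJ_eq_zero_of_not_mem_tube (s := D.s) hJ htr
    simp [Jet.frame, h1, h2]

include h in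
/-- The fast product `η_x²ψ̃_x²` vanishes off the support of the jet `x`. [folklore] -/
theorem fastF_eq_zero_of_not_mem (x : Idx) (t : ℝ) {y : 𝕋³} (hy : y ∉ Jet.jetSupport (D.J x) D.s x t) :
    Jet.fastF (D.J x) D.s x t y = 0 := by
  have hJ := Jvalid h x
  unfold Jet.fastF
  exact Jet.axial_mul_transverse_eq_zero_of_not_mem hy
    (fun htr hy' => by rw [Jet.eta_eq_zero_of_not_mem hJ hy' htr]; ring)
    (fun htr => by rw [Jet.psiJ_eq_zero_of_not_mem_tube (s := D.s) hJ htr]; ring)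

include h in
/-- `wpc(t)` vanishes off the jet supports (the columns `a_x Om_x eⱼ` vanish on the open
complement, hence so do their divergences). [cite: LuoTiti2020, §3.4 (3.13)] -/
theorem wpc_eq_zero_of_not_mem (t : ℝ) {y : 𝕋³} (hy : y ∉ D.jetSupports t) : D.wpc t y = 0 := by
  have hU : IsOpen (D.jetSupports t)ᶜ := (isClosed_jetSupports t).isOpen_compl
  show ∑ x, Torus.tensorDivergence (fun z j => D.a x t z • Jet.Om (D.J x) D.s x t z j) y = 0
  refine Finset.sum_eq_zero fun x _ => Finset.sum_eq_zero fun j _ => ?_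
  refine Torus.partialDeriv_eq_zero_of_forall_mem_isOpen hU (fun z hz => ?_) j hy
  have hz' : z ∉ Jet.jetSupport (D.J x) D.s x t := fun hm => hz (mem_iUnion.2 ⟨x, hm⟩)
  show D.a x t z • Jet.Om (D.J x) D.s x t z j = 0
  rw [Om_eq_zero_of_not_mem h x t hz' j, smul_zero]

include h in
/-- `F_x(t) = a_x² η_x²ψ̃_x²` vanishes off the support of the jet `x`. [folklore] -/
theorem F_eq_zero_of_not_mem (x : Idx) (t : ℝ) {y : 𝕋³} (hy : y ∉ Jet.jetSupport (D.J x) D.s x t) : D.F x t y = 0 := by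
  unfold F
  rw [fastF_eq_zero_of_not_mem h x t hy, mul_zero]

include h in
/-- `X₀(t)` vanishes off the jet supports. [folklore] -/
theorem X₀_eq_zero_of_not_mem (t : ℝ) {y : 𝕋³} (hy : y ∉ D.jetSupports t) : D.X₀ t y = 0 := by
  unfold X₀
  rw [neg_eq_zero]
  refine Finset.sum_eq_zero fun x _ => ?_
  have hy' : y ∉ Jet.jetSupport (D.J x) D.s x t := fun hm => hy (mem_iUnion.2 ⟨x, hm⟩)
  rw [F_eq_zero_of_not_mem h x t hy', mul_zero, zero_smul]

include h in
/-- **All space derivatives of `wpc(t)` and `X(t)` vanish off the jet supports.** [folklore] -/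
theorem derivs_eq_zero_of_not_mem {t : ℝ} (ht : t ∈ Icc 0 D.T) (m : Fin 3) {y : 𝕋³} (hy : y ∉ D.jetSupports t) :
    Torus.partialDeriv m (D.wpc t) y = 0 ∧ Torus.laplacian (Torus.partialDeriv m (D.wpc t)) y = 0 ∧
    Torus.partialDeriv m (D.X t) y = 0 ∧ Torus.laplacian (Torus.partialDeriv m (D.X t)) y = 0 := by
  have hE := isClosed_jetSupports (D := D) t
  have hwpc : Torus.IsSmooth (D.wpc t) := (smooth_wpc h).isSmooth_slice ht
  have hX₀ := isSmooth_X₀ h ht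
  have h0w : ∀ z ∉ D.jetSupports t, D.wpc t z = 0 := fun z hz => wpc_eq_zero_of_not_mem h t hz
  have h0X : ∀ z ∉ D.jetSupports t, D.X₀ t z = 0 := fun z hz => X₀_eq_zero_of_not_mem h t hz
  refine ⟨Torus.partialDeriv_eq_zero_off hE h0w m hy, Torus.laplacian_partialDeriv_eq_zero_off hwpc hE h0w m hy, ?_, ?_⟩
  · rw [partialDeriv_X_eq h ht m]; exact Torus.partialDeriv_eq_zero_off hE h0X m hy
  · rw [partialDeriv_X_eq h ht m]; exact Torus.laplacian_partialDeriv_eq_zero_off hX₀ hE h0X m hy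

end Datum

end JetStep

/-! ## The hyperviscous term of the cut-off perturbation -/

namespace LuoTiti

open Literature.Analysis.FunctionSpaces FunctionSpaces.Torus Mikado NashGeometric Jet JetStep

local notation "𝕋³" => UnitAddTorus (Fin 3)
local notation "E³" => EuclideanSpace ℝ (Fin 3)
local notation "Idx" => Index (Fin 3)

namespace Setup

variable {S : Setup} (h : S.Valid)
include h

/-- **Derivative bounds of `∂ₘ wloc(t)`**: from `C⁴` bounds of the amplitudes and the block
bounds of order `4`, each `∂ₘ wloc(t)` (`wloc = ψ wpc + ψ² X`, `0 ≤ ψ ≤ 1`) has bounds of order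
`2` with constant `S₁ = C_w L⋆ + C_X L⋆` at frequency `L⋆`. [cite: LuoTiti2020, §3.5 (3.16)] -/
theorem hasDerivBounds_partialDeriv_wloc (hκμ : S.D.κ ≤ S.D.μ) {K : ℝ} (hK : S.D.BlockBounds 4 K) {Ca : ℝ} {t : ℝ}
    (ht : t ∈ Icc 0 S.D.T) (ha : ∀ x, HasDerivBounds 4 (S.D.a x t) Ca 1) (m : Fin 3) :
    HasDerivBounds 2 (Torus.partialDeriv m (S.wloc t))
      (NN * (3 * (2 ^ 4 * Ca * (K * Real.sqrt S.D.κ * ((S.D.σ : ℝ))⁻¹) * S.D.Lstar)) * S.D.Lstar +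
        NN * (2 ^ 3 * (S.D.mup⁻¹ * (2 ^ 3 * (2 ^ 3 * Ca * Ca) * (K * S.D.κ * S.D.μ ^ 2))) * 3) * S.D.Lstar) S.D.Lstar := by
  have hD := h.hD
  obtain ⟨hL1, -, -⟩ := Datum.Lstar_bounds hD hκμ
  have hL0 : 0 ≤ S.D.Lstar := zero_le_one.trans hL1
  have hK3 : S.D.BlockBounds 3 K := fun x s => ⟨(hK x s).1.of_succ, fun j => ((hK x s).2.1 j).of_succ, (hK x s).2.2.of_succ⟩
  have ha3 : ∀ x, HasDerivBounds 3 (S.D.a x t) Ca 1 := fun x => (ha x).of_succ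
  have hw : HasDerivBounds 3 (S.D.wpc t) _ S.D.Lstar := Datum.hasDerivBounds_wpc hD hκμ (N := 3) hK ha
  have hX : HasDerivBounds 3 (S.D.X₀ t) _ S.D.Lstar := Datum.hasDerivBounds_X₀ hD hκμ (N := 3) hK3 ha3
  have hwm := hw.partialDeriv m
  have hXm := hX.partialDeriv m
  have hwpcs : Torus.IsSmooth (S.D.wpc t) := (Datum.smooth_wpc hD).isSmooth_slice ht
  have hXs : Torus.IsSmooth (S.D.X t) := (Datum.smooth_X hD).isSmooth_slice ht
  -- `∂ₘ wloc = ψ ∂ₘ wpc + ψ² ∂ₘ X₀`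
  have e : Torus.partialDeriv m (S.wloc t) = fun y => S.ψ t • Torus.partialDeriv m (S.D.wpc t) y +
      (S.ψ t) ^ 2 • Torus.partialDeriv m (S.D.X₀ t) y := by
    funext y
    have e1 : S.wloc t = (S.ψ t • S.D.wpc t) + ((S.ψ t) ^ 2 • S.D.X t) := by funext z; rfl
    rw [e1, partialDeriv_add ((hwpcs.smul _).isContDiff (by simp)) ((hXs.smul _).isContDiff (by simp)) m,
      partialDeriv_const_smul (hwpcs.isContDiff (by simp)), partialDeriv_const_smul (hXs.isContDiff (by simp)),
      Datum.partialDeriv_X_eq hD ht m]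
    rfl
  rw [e]
  have h1 := hwm.const_smul (S.ψ t)
  have h2 := hXm.const_smul ((S.ψ t) ^ 2)
  refine (h1.add h2).mono ?_ hL0 le_rfl
  obtain ⟨hψ0, hψ1⟩ := h.hψ01 t
  have a1 : |S.ψ t| ≤ 1 := by rw [abs_of_nonneg hψ0]; exact hψ1
  have a2 : |(S.ψ t) ^ 2| ≤ 1 := by rw [abs_of_nonneg (sq_nonneg _)]; nlinarith
  have c1 := hwm.nonneg
  have c2 := hXm.nonneg
  nlinarith [abs_nonneg (S.ψ t), abs_nonneg ((S.ψ t) ^ 2)]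

/-- **The hyperviscous stress term of Luo–Titi's perturbation** (the estimate (3.20) of the
paper, in `sup × |support|^{1/p}` form): for `1 ≤ θ < 2`, `1 < p < ∞`, with the constant `C` of
`FracHyperviscousEstimate`, block bounds of order `4` and `C⁴` amplitude bounds at time `t`,
`∫‖ℛ((-Δ)^θ wloc(t))‖ ≤ C |E(t)|^{1/p} S₁^{2-θ} (3 S₁ L⋆²)^{θ-1}`, where `E(t)` is the union of
the jet supports and `S₁` the first-derivative sup bound of `hasDerivBounds_partialDeriv_wloc`.
[cite: LuoTiti2020, §3.5 (3.20)] -/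
theorem eLpNorm_antidivergence_fracLaplacian_wloc_le {θ : ℝ} {p : ℝ≥0∞} {C : ℝ≥0}
    (hC : ∀ u : 𝕋³ → E³, Torus.IsSmooth u → ∀ E : Set 𝕋³, MeasurableSet E →
      (∀ m, ∀ y ∉ E, Torus.partialDeriv m u y = 0) → (∀ m, ∀ y ∉ E, Torus.laplacian (Torus.partialDeriv m u) y = 0) →
      ∀ S₁ S₃ : ℝ, 0 ≤ S₁ → 0 ≤ S₃ → (∀ m y, ‖Torus.partialDeriv m u y‖ ≤ S₁) →
      (∀ m y, ‖Torus.laplacian (Torus.partialDeriv m u) y‖ ≤ S₃) →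
      eLpNorm (Torus.antidivergence (Torus.fracLaplacian θ u)) 1 volume ≤
        C * (volume E ^ (1 / p.toReal) * ENNReal.ofReal (S₁ ^ (2 - θ) * S₃ ^ (θ - 1))))
    (hκμ : S.D.κ ≤ S.D.μ) {K : ℝ} (hK : S.D.BlockBounds 4 K) {Ca : ℝ} {t : ℝ} (ht : t ∈ Icc 0 S.D.T)
    (ha : ∀ x, HasDerivBounds 4 (S.D.a x t) Ca 1) :
    let S₁ : ℝ := NN * (3 * (2 ^ 4 * Ca * (K * Real.sqrt S.D.κ * ((S.D.σ : ℝ))⁻¹) * S.D.Lstar)) * S.D.Lstar +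
        NN * (2 ^ 3 * (S.D.mup⁻¹ * (2 ^ 3 * (2 ^ 3 * Ca * Ca) * (K * S.D.κ * S.D.μ ^ 2))) * 3) * S.D.Lstar
    eLpNorm (Torus.antidivergence (Torus.fracLaplacian θ (S.wloc t))) 1 volume ≤
      C * (volume (S.D.jetSupports t) ^ (1 / p.toReal) * ENNReal.ofReal (S₁ ^ (2 - θ) * (3 * (S₁ * S.D.Lstar ^ 2)) ^ (θ - 1))) := by
  intro S₁
  have hD := h.hD
  have hb := fun m => hasDerivBounds_partialDeriv_wloc h hκμ hK ht ha m
  have hS₁ : 0 ≤ S₁ := (hb 0).nonneg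
  obtain ⟨hL1, -, -⟩ := Datum.Lstar_bounds hD hκμ
  have hwl : Torus.IsSmooth (S.wloc t) := (smooth_wloc h).isSmooth_slice (mem_univ t)
  have hwpcs : Torus.IsSmooth (S.D.wpc t) := (Datum.smooth_wpc hD).isSmooth_slice ht
  have hXs : Torus.IsSmooth (S.D.X t) := (Datum.smooth_X hD).isSmooth_slice ht
  -- vanishing off the supports
  have hlin : ∀ m y, Torus.partialDeriv m (S.wloc t) y = S.ψ t • Torus.partialDeriv m (S.D.wpc t) y +
      (S.ψ t) ^ 2 • Torus.partialDeriv m (S.D.X t) y := by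
    intro m y
    have e1 : S.wloc t = (S.ψ t • S.D.wpc t) + ((S.ψ t) ^ 2 • S.D.X t) := by funext z; rfl
    rw [e1, partialDeriv_add ((hwpcs.smul _).isContDiff (by simp)) ((hXs.smul _).isContDiff (by simp)) m,
      partialDeriv_const_smul (hwpcs.isContDiff (by simp)), partialDeriv_const_smul (hXs.isContDiff (by simp))]
    rfl
  have hlin' : ∀ m, Torus.partialDeriv m (S.wloc t) = (S.ψ t • Torus.partialDeriv m (S.D.wpc t)) +
      ((S.ψ t) ^ 2 • Torus.partialDeriv m (S.D.X t)) := fun m => funext fun y => by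
    rw [hlin m y]; rfl
  have hv1 : ∀ m, ∀ y ∉ S.D.jetSupports t, Torus.partialDeriv m (S.wloc t) y = 0 := by
    intro m y hy
    obtain ⟨a1, -, a3, -⟩ := Datum.derivs_eq_zero_of_not_mem hD ht m hy
    rw [hlin m y, a1, a3, smul_zero, smul_zero, add_zero]
  have hv3 : ∀ m, ∀ y ∉ S.D.jetSupports t, Torus.laplacian (Torus.partialDeriv m (S.wloc t)) y = 0 := by
    intro m y hy
    obtain ⟨-, a2, -, a4⟩ := Datum.derivs_eq_zero_of_not_mem hD ht m hy
    have s1 : Torus.IsSmooth (Torus.partialDeriv m (S.D.wpc t)) := hwpcs.partialDeriv m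
    have s2 : Torus.IsSmooth (Torus.partialDeriv m (S.D.X t)) := hXs.partialDeriv m
    rw [hlin' m, laplacian_add_apply (s1.smul _) (s2.smul _) y, Torus.laplacian_const_smul' s1, Torus.laplacian_const_smul' s2,
      a2, a4, smul_zero, smul_zero, add_zero]
  -- sup bounds
  have hsup1 : ∀ m y, ‖Torus.partialDeriv m (S.wloc t) y‖ ≤ S₁ := fun m y => (hb m).norm_le y
  have hsup3 : ∀ m y, ‖Torus.laplacian (Torus.partialDeriv m (S.wloc t)) y‖ ≤ 3 * (S₁ * S.D.Lstar ^ 2) := by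
    intro m y
    have := (hb m).norm_laplacian_le le_rfl y
    rwa [Fintype.card_fin, Nat.cast_ofNat] at this
  exact hC (S.wloc t) hwl (S.D.jetSupports t) (Datum.measurableSet_jetSupports t) hv1 hv3 S₁ (3 * (S₁ * S.D.Lstar ^ 2)) hS₁
    (by positivity) hsup1 hsup3

end Setup

end LuoTiti

end Literature.Analysis.FluidPDE
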